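import Summits.BirchSwinnertonDyer.Rank1Residual.GaloisImage.KolyvaginSystemRestriction
import Summits.BirchSwinnertonDyer.Rank1Residual.GaloisImage.KolyvaginScalarTransportLocal
import Literature.NumberTheory.EllipticCurves.KummerSelmerStructure
import HarnessLib

/-!
# Route `KimAtThreeKolyvagin` (rung W2), crux `StubAtEmptyLevelThree` (item 19561): the
# `∀`-SUB-DATA quantifier — transfer of the stub at the empty level from a datum to its sub-data,
# and the prime-free datum

Cell `bsd-addord`, seat `bsd-addord-w2-c5` (item `stmt-BirchSwinnertonDyer-19561`).  TOOL theorems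
(no definition, no named fact, no `sorry`; nothing is asserted about any curve beyond its hypotheses).

WHY.  The crux `KimAtThreeKolyvagin.StubAtEmptyLevelThree` (the binder `hStub` of w2-c3's
end-of-ports theorem closed over `(W, η)`) quantifies over EVERY `τ`-datum `Dk` guarded by
`IsCanonicalTauDatumThreeAtWith W k k η` — and that guard only asks `Dk.primes ⊆ frobeniusClassPrimes …`
(ANY subset of a Sakamoto `τ`-class, even a finite or empty one), whereas every printed road to the
stub (Mazur–Rubin Thm. 4.4.1 / 4.4.3, Sakamoto Thm. 4.4) and the tree's typed fact
`Sakamoto2024.kolyvaginSystems_freeRankOne_zmod_three_pow` need `𝒫 =` the full (Chebotarev-rich)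
class.  This file settles what the DEFINITIONS alone give about the sub-data:

* §1 (any number field, any finite-level module, pure algebra of `KS₁`):
  `KSSub.eq_of_restrict_eq` — restriction `KS₁(T,𝓕,𝒫) → KS₁(T,𝓕,𝒫′)` (`𝒫′ ⊆ 𝒫`, the tree's
  `KSRestrict.isKolyvaginSystem_restrict`) is INJECTIVE as soon as `𝒫′` contains one level `d₀` at
  which evaluation `κ ↦ κ_{d₀}` is injective on `KS₁(T,𝓕,𝒫)`;
  `KSSub.natCard_le_of_forall_eq_nsmul` — an `ℕ`-cyclic subgroup `X = ℕ•g` with `n•g = 0` has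
  `#X ≤ n`; ★ `KSSub.exists_restrict_eq_of_injective_eval` — if moreover `#KS₁(T,𝓕,𝒫) ≥ n` where
  `n` kills `H¹(K,T)`, then restriction is a BIJECTION onto any `ℕ`-cyclic `KS₁(T,𝓕,𝒫′)`: the
  `ℕ`-generator `g′` of the sub-datum IS the restriction of an `ℕ`-generator of the datum.
* §2 (`T = E[3^{k+1}]`, `𝓕 = 𝓕_can`, the crux's currency):
  ★ `exists_eq_nsmul_add_of_subdatum` — the crux's conclusion
  `g′_∅ ∈ 3^{n₀} H¹_{𝓕_can} + H¹_𝓚` for the `ℕ`-generator of a SUB-datum `Dk′ ⊑ Dk` follows from the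
  same conclusion for the `ℕ`-generators of `Dk`, given `#KS(Dk) ≥ 3^{k+1}` and one level of `Dk′`
  with injective evaluation on `KS(Dk)` (`g′_∅ = g_∅`: the bottom class is unchanged by restriction);
  `exists_eq_nsmul_add_of_subdatum_of_freeRankOne` — the same with the two inputs read off the
  typed shape of [S24] Thm. 4.4 (1) (`IsFreeRankOneZMod (KS Dk) 3^{k+1}` and bijectivity of
  evaluation at a level `d₀ ⊆ Dk′.primes`), so every sub-datum keeping ONE core vertex of the full
  datum inherits the stub;
  ★ `exists_eq_nsmul_add_of_primes_eq_empty` — at the other extreme, a datum with NO Kolyvagin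
  primes has `KS₁ ≅ H¹_{𝓕_can}` (`κ ↦ κ_∅`), so `ℕ`-cyclicity forces `#H¹_{𝓕_can} ≤ 3^{k+1}`, i.e.
  `n₀ = 0`, and the crux's conclusion holds with `e = g_∅`, `m = 0` — the prime-free sub-data are
  harmless.
What is NOT here: the stub for the full datum (Mazur–Rubin Thm. 4.4.3 road, seats w2-c3 / w2-c2,
conditional on Poitou–Tate and [S24]); sub-data with no injectivity vertex and `n₀ ≥ 1` (open).
[cite: MazurRubin2004, Def. 3.1.3 and Thm. 4.4.1] [cite: Sakamoto2024, Def. 4.1 and Thm. 4.4 (1) (p. 926)]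
[cite: Rubin2011, Def. 2.2.1 (p. 18)]
-/

set_option autoImplicit false
-- the Theorems namespace of a single-conjunct summit repeats the summit name by design (D-0017)
set_option linter.dupNamespace false

noncomputable section

open scoped Classical NumberField ContRepresentation
open Function NumberField IsDedekindDomain WeierstrassCurve
  Literature.NumberTheory.EllipticCurves
  Literature.NumberTheory.GaloisRepresentations
  Literature.NumberTheory.GaloisRepresentations.DiscreteGaloisModule Literature.NumberTheory.GaloisCohomology
  Summit.BirchSwinnertonDyer.Rank1Residual.GaloisImage

universe u

namespace Summit.BirchSwinnertonDyer.BirchSwinnertonDyer.Theorems.KimAtThreeStubSubdatum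

/-! ## §1 Restriction of Kolyvagin systems to sub-data: injectivity and bijectivity -/

namespace KSSub

variable {K : Type u} [Field K] [NumberField K]
variable {M : Type u} [AddCommGroup M] [TopologicalSpace M] [DiscreteTopology M]
variable {ρ : DiscreteGaloisModule K M}

/-- Restriction (extension by zero off the levels of `D′`) commutes with the `ℕ`-action.
[cite: Sakamoto2024, Def. 4.1 (p. 926), "the R-module KS₁(T, 𝓕)"] -/
theorem restrict_nsmul (D' : KolyvaginDatum ρ) (a : ℕ)
    (κ : Finset (HeightOneSpectrum (𝓞 K)) → galoisCohomology ρ 1) :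
    (fun d => if D'.IsLevel d then (a • κ) d else 0) =
      a • fun d => if D'.IsLevel d then κ d else 0 := by
  funext d
  by_cases hd : D'.IsLevel d <;> simp [hd]

/-- **Restriction to a sub-datum is injective on `KS₁(T, 𝓕, 𝒫)` as soon as the sub-datum keeps a
level `d₀` at which evaluation `κ ↦ κ_{d₀}` is injective on `KS₁(T, 𝓕, 𝒫)`** (the restricted family
has the SAME class at every common level, in particular at `d₀`).
[cite: MazurRubin2004, Def. 3.1.3] [cite: Sakamoto2024, Def. 4.1 (p. 926)] -/
theorem eq_of_restrict_eq {D D' : KolyvaginDatum ρ} {𝓕 : SelmerStructure ρ}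
    {d₀ : Finset (HeightOneSpectrum (𝓞 K))} (hd₀ : D'.IsLevel d₀)
    (hinj : ∀ κ ∈ D.kolyvaginSystems 𝓕, κ d₀ = 0 → κ = 0)
    {κ₁ κ₂ : Finset (HeightOneSpectrum (𝓞 K)) → galoisCohomology ρ 1}
    (h₁ : κ₁ ∈ D.kolyvaginSystems 𝓕) (h₂ : κ₂ ∈ D.kolyvaginSystems 𝓕)
    (h : (fun d => if D'.IsLevel d then κ₁ d else 0) = fun d => if D'.IsLevel d then κ₂ d else 0) :
    κ₁ = κ₂ := by
  have hd : κ₁ d₀ = κ₂ d₀ := by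
    have := congr_fun h d₀
    simpa [hd₀] using this
  have h0 : (κ₁ - κ₂) d₀ = 0 := by simp [hd]
  exact sub_eq_zero.mp (hinj _ (sub_mem h₁ h₂) h0)

omit [NumberField K] in
/-- **An `ℕ`-cyclic subgroup killed by `n` has at most `n` elements**: if every element of `X` is
`a • g` for some `a : ℕ`, `g ∈ X` and `n • g = 0` (`n ≥ 1`), then `a ↦ a • g`, `a < n`, is onto `X`.
[folklore] -/
theorem natCard_le_of_forall_eq_nsmul {G : Type*} [AddCommGroup G] (X : AddSubgroup G) {g : G}
    (hg : g ∈ X) (hgen : ∀ x ∈ X, ∃ a : ℕ, x = a • g) {n : ℕ} (hn0 : 0 < n) (hn : n • g = 0) :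
    Finite X ∧ Nat.card X ≤ n := by
  let φ : Fin n → X := fun a => ⟨(a : ℕ) • g, X.nsmul_mem hg _⟩
  have hφ : Surjective φ := by
    rintro ⟨x, hx⟩
    obtain ⟨a, rfl⟩ := hgen x hx
    refine ⟨⟨a % n, Nat.mod_lt a hn0⟩, Subtype.ext ?_⟩
    change (a % n) • g = a • g
    conv_rhs => rw [← Nat.mod_add_div a n]
    rw [add_nsmul, mul_comm, ← smul_smul, hn, smul_zero, add_zero]
  haveI : Finite X := Finite.of_surjective φ hφ
  exact ⟨this, (Nat.card_le_card_of_surjective φ hφ).trans (Nat.card_fin n).le⟩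

/-- **Restriction is a bijection onto an `ℕ`-cyclic `KS₁` of a sub-datum, and pulls the
`ℕ`-generator back.**  Let `𝒫(D′) ⊆ 𝒫(D)` with the same transverse conditions and the same
comparison maps at the primes of `D′`; let `n ≥ 1` kill `H¹(K, T)` and `#KS₁(T,𝓕,𝒫(D)) ≥ n`; let
`d₀` be a level of `D′` with `κ ↦ κ_{d₀}` injective on `KS₁(T,𝓕,𝒫(D))`.  If `KS₁(T,𝓕,𝒫(D′)) = ℕ•g′`,
then `g′` is the restriction of some `κ ∈ KS₁(T,𝓕,𝒫(D))` with `KS₁(T,𝓕,𝒫(D)) = ℕ•κ`.  (Counting: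
`n ≤ #KS(D) ≤ #KS(D′) ≤ n`, restriction being injective and `KS(D′)` `ℕ`-cyclic of exponent `n`.)
[cite: MazurRubin2004, Def. 3.1.3 and Thm. 4.4.1] [cite: Sakamoto2024, Def. 4.1 (p. 926)] -/
theorem exists_restrict_eq_of_injective_eval {D D' : KolyvaginDatum ρ} {𝓕 : SelmerStructure ρ}
    (hPP : D'.primes ⊆ D.primes) (hT : D'.transverse = D.transverse)
    (hfs : ∀ q ∈ D'.primes, D'.fs q = D.fs q)
    {n : ℕ} (hn0 : 0 < n) (hn : ∀ c : galoisCohomology ρ 1, n • c = 0)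
    (hcard : n ≤ Nat.card (D.kolyvaginSystems 𝓕))
    {d₀ : Finset (HeightOneSpectrum (𝓞 K))} (hd₀ : D'.IsLevel d₀)
    (hinj : ∀ κ ∈ D.kolyvaginSystems 𝓕, κ d₀ = 0 → κ = 0)
    {g' : Finset (HeightOneSpectrum (𝓞 K)) → galoisCohomology ρ 1}
    (hg' : g' ∈ D'.kolyvaginSystems 𝓕)
    (hgen' : ∀ κ' ∈ D'.kolyvaginSystems 𝓕, ∃ a : ℕ, κ' = a • g') :
    ∃ κ ∈ D.kolyvaginSystems 𝓕, (∀ κ₁ ∈ D.kolyvaginSystems 𝓕, ∃ a : ℕ, κ₁ = a • κ) ∧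
      (fun d => if D'.IsLevel d then κ d else 0) = g' := by
  -- the restriction map `r : KS(D) → KS(D′)`
  have hmem : ∀ κ ∈ D.kolyvaginSystems 𝓕,
      (fun d => if D'.IsLevel d then κ d else 0) ∈ D'.kolyvaginSystems 𝓕 := fun κ hκ =>
    (KolyvaginDatum.mem_kolyvaginSystems_iff _ _ _).2
      (KSRestrict.isKolyvaginSystem_restrict
        ((KolyvaginDatum.mem_kolyvaginSystems_iff _ _ _).1 hκ) hPP hT hfs)
  let r : D.kolyvaginSystems 𝓕 → D'.kolyvaginSystems 𝓕 :=
    fun κ => ⟨fun d => if D'.IsLevel d then κ.1 d else 0, hmem κ.1 κ.2⟩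
  have hr : Injective r := by
    rintro ⟨κ₁, h₁⟩ ⟨κ₂, h₂⟩ h
    exact Subtype.ext (eq_of_restrict_eq hd₀ hinj h₁ h₂ (congrArg Subtype.val h))
  -- `KS(D′)` is finite of cardinality `≤ n`
  have hng' : n • g' = 0 := funext fun d => by simpa using hn (g' d)
  obtain ⟨hfin', hcard'⟩ := natCard_le_of_forall_eq_nsmul (D'.kolyvaginSystems 𝓕) hg' hgen' hn0 hng'
  haveI := hfin'
  -- hence `r` is a bijection
  have hbij : Bijective r :=
    hr.bijective_of_nat_card_le (hcard'.trans hcard)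
  obtain ⟨⟨κ, hκ⟩, hκg⟩ := hbij.2 ⟨g', hg'⟩
  have hres : (fun d => if D'.IsLevel d then κ d else 0) = g' := congrArg Subtype.val hκg
  refine ⟨κ, hκ, fun κ₁ hκ₁ => ?_, hres⟩
  obtain ⟨a, ha⟩ := hgen' _ (hmem κ₁ hκ₁)
  refine ⟨a, eq_of_restrict_eq hd₀ hinj hκ₁ (AddSubgroup.nsmul_mem _ hκ a) ?_⟩
  rw [ha, restrict_nsmul, hres]

end KSSub

/-! ## §2 The crux's currency: `T = E[3^{k+1}]`, `𝓕 = 𝓕_can`, the Kummer structure `𝓚` -/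

variable (W : WeierstrassCurve ℚ) [W.IsElliptic]

/-- **The stub at the empty level passes to sub-data keeping an injectivity vertex.**  Let `Dk′ ⊑ Dk`
be Kolyvagin data for `E[3^{k+1}]` (`Dk′.primes ⊆ Dk.primes`, same transverse conditions, same
comparison maps on `Dk′.primes`) with `#KS(E[3^{k+1}], 𝓕_can, Dk) ≥ 3^{k+1}` and a level `d₀` of `Dk′`
at which evaluation is injective on `KS(…, Dk)`.  If EVERY `ℕ`-generator `g` of `KS(…, Dk)` has
`g_∅ = 3^{n₀}•e + m` with `e ∈ H¹_{𝓕_can}(ℚ, E[3^{k+1}])`, `m ∈ H¹_𝓚(ℚ, E[3^{k+1}])`, then so does every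
`ℕ`-generator `g′` of `KS(…, Dk′)` — indeed `g′` is the restriction of such a `g` and `g′_∅ = g_∅`.
[cite: MazurRubin2004, Thm. 4.4.1 and Def. 4.3.1] [cite: Sakamoto2024, Thm. 4.4 (p. 926)] -/
theorem exists_eq_nsmul_add_of_subdatum (k n₀ : ℕ)
    {Dk Dk' : KolyvaginDatum (W.torsionGaloisModule (((3 : ℕ) : ℤ) ^ k * ((3 : ℕ) : ℤ)))}
    (hPP : Dk'.primes ⊆ Dk.primes) (hT : Dk'.transverse = Dk.transverse)
    (hfs : ∀ q ∈ Dk'.primes, Dk'.fs q = Dk.fs q)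
    (hcard : 3 ^ (k + 1) ≤ Nat.card (Dk.kolyvaginSystems (propagatedSelmerStructure W 3 k)))
    {d₀ : Finset (HeightOneSpectrum (𝓞 ℚ))} (hd₀ : Dk'.IsLevel d₀)
    (hinj : ∀ κ ∈ Dk.kolyvaginSystems (propagatedSelmerStructure W 3 k), κ d₀ = 0 → κ = 0)
    (hfull : ∀ g ∈ Dk.kolyvaginSystems (propagatedSelmerStructure W 3 k),
      (∀ κ ∈ Dk.kolyvaginSystems (propagatedSelmerStructure W 3 k), ∃ a : ℕ, κ = a • g) →
      ∃ e ∈ (propagatedSelmerStructure W 3 k).selmerGroup,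
        ∃ m ∈ (W.kummerSelmerStructure (((3 : ℕ) : ℤ) ^ k * ((3 : ℕ) : ℤ))).selmerGroup,
          g ∅ = 3 ^ n₀ • e + m)
    {g' : Finset (HeightOneSpectrum (𝓞 ℚ)) →
      galoisCohomology (W.torsionGaloisModule (((3 : ℕ) : ℤ) ^ k * ((3 : ℕ) : ℤ))) 1}
    (hg' : g' ∈ Dk'.kolyvaginSystems (propagatedSelmerStructure W 3 k))
    (hgen' : ∀ κ' ∈ Dk'.kolyvaginSystems (propagatedSelmerStructure W 3 k), ∃ a : ℕ, κ' = a • g') :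
    ∃ e ∈ (propagatedSelmerStructure W 3 k).selmerGroup,
      ∃ m ∈ (W.kummerSelmerStructure (((3 : ℕ) : ℤ) ^ k * ((3 : ℕ) : ℤ))).selmerGroup,
        g' ∅ = 3 ^ n₀ • e + m := by
  obtain ⟨κ, hκ, hgen, hres⟩ := KSSub.exists_restrict_eq_of_injective_eval hPP hT hfs
    (Nat.pos_of_ne_zero (by positivity)) (Transport.pow_succ_nsmul_galoisCohomology W k) hcard hd₀ hinj hg' hgen'
  obtain ⟨e, he, m, hm, h⟩ := hfull κ hκ hgen
  refine ⟨e, he, m, hm, ?_⟩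
  rw [← hres]
  simpa only [if_pos Dk'.isLevel_empty] using h

/-- **The same transfer with the two inputs in the typed shape of [S24] Thm. 4.4 (1)**:
`KS(E[3^{k+1}], 𝓕_can, Dk)` free of rank one over `ℤ/3^{k+1}` (`IsFreeRankOneZMod`) and evaluation at
a level `d₀ ⊆ Dk′.primes` injective on it (the typed fact's bijectivity clause at a vertex with
`λ^* = 0`).  So every sub-datum of a Sakamoto datum that keeps ONE core vertex of it inherits the stub
at the empty level. [cite: Sakamoto2024, Thm. 4.4 (1) (p. 926)] [cite: MazurRubin2004, Thm. 4.4.1] -/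
theorem exists_eq_nsmul_add_of_subdatum_of_freeRankOne (k n₀ : ℕ)
    {Dk Dk' : KolyvaginDatum (W.torsionGaloisModule (((3 : ℕ) : ℤ) ^ k * ((3 : ℕ) : ℤ)))}
    (hPP : Dk'.primes ⊆ Dk.primes) (hT : Dk'.transverse = Dk.transverse)
    (hfs : ∀ q ∈ Dk'.primes, Dk'.fs q = Dk.fs q)
    (hfree : KolyvaginSystem.IsFreeRankOneZMod
      (Dk.kolyvaginSystems (propagatedSelmerStructure W 3 k)) (3 ^ (k + 1)))
    {d₀ : Finset (HeightOneSpectrum (𝓞 ℚ))} (hd₀ : Dk'.IsLevel d₀)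
    (hinj : Injective fun κ : Dk.kolyvaginSystems (propagatedSelmerStructure W 3 k) => κ.1 d₀)
    (hfull : ∀ g ∈ Dk.kolyvaginSystems (propagatedSelmerStructure W 3 k),
      (∀ κ ∈ Dk.kolyvaginSystems (propagatedSelmerStructure W 3 k), ∃ a : ℕ, κ = a • g) →
      ∃ e ∈ (propagatedSelmerStructure W 3 k).selmerGroup,
        ∃ m ∈ (W.kummerSelmerStructure (((3 : ℕ) : ℤ) ^ k * ((3 : ℕ) : ℤ))).selmerGroup,
          g ∅ = 3 ^ n₀ • e + m)
    {g' : Finset (HeightOneSpectrum (𝓞 ℚ)) →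
      galoisCohomology (W.torsionGaloisModule (((3 : ℕ) : ℤ) ^ k * ((3 : ℕ) : ℤ))) 1}
    (hg' : g' ∈ Dk'.kolyvaginSystems (propagatedSelmerStructure W 3 k))
    (hgen' : ∀ κ' ∈ Dk'.kolyvaginSystems (propagatedSelmerStructure W 3 k), ∃ a : ℕ, κ' = a • g') :
    ∃ e ∈ (propagatedSelmerStructure W 3 k).selmerGroup,
      ∃ m ∈ (W.kummerSelmerStructure (((3 : ℕ) : ℤ) ^ k * ((3 : ℕ) : ℤ))).selmerGroup,
        g' ∅ = 3 ^ n₀ • e + m := by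
  obtain ⟨φ⟩ := hfree
  have hcard : 3 ^ (k + 1) ≤ Nat.card (Dk.kolyvaginSystems (propagatedSelmerStructure W 3 k)) := by
    rw [Nat.card_congr φ.toEquiv, Nat.card_zmod]
  refine exists_eq_nsmul_add_of_subdatum W k n₀ hPP hT hfs hcard hd₀ (fun κ hκ h0 => ?_) hfull hg' hgen'
  have h := @hinj ⟨κ, hκ⟩ ⟨0, zero_mem _⟩ (by simpa using h0)
  exact congrArg Subtype.val h

/-- **A datum with NO Kolyvagin primes is harmless for the crux.**  If `Dk.primes = ∅`, every class
`s ∈ H¹_{𝓕_can}(ℚ, E[3^{k+1}])` is the bottom class of the Kolyvagin system `(∅ ↦ s, d ↦ 0)` (the only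
level is `∅`, there is no finite–singular relation to check), so `ℕ`-cyclicity of `KS` makes
`H¹_{𝓕_can} ⊆ ℕ•g_∅`, whence `#H¹_{𝓕_can} ≤ 3^{k+1}`; with `#H¹_{𝓕_can} = 3^{k+1}·3^{n₀}` this forces
`n₀ = 0` and the crux's conclusion holds with `e = g_∅ ∈ H¹_{𝓕_can}`, `m = 0 ∈ H¹_𝓚`.
[cite: Sakamoto2024, §2 (p. 921), "the trivial ideal 1 belongs to 𝒩", and Def. 4.1]
[cite: MazurRubin2004, Def. 3.1.3] -/
theorem exists_eq_nsmul_add_of_primes_eq_empty (k n₀ : ℕ)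
    {Dk : KolyvaginDatum (W.torsionGaloisModule (((3 : ℕ) : ℤ) ^ k * ((3 : ℕ) : ℤ)))}
    (hP : Dk.primes = ∅)
    {g : Finset (HeightOneSpectrum (𝓞 ℚ)) →
      galoisCohomology (W.torsionGaloisModule (((3 : ℕ) : ℤ) ^ k * ((3 : ℕ) : ℤ))) 1}
    (hg : g ∈ Dk.kolyvaginSystems (propagatedSelmerStructure W 3 k))
    (hgen : ∀ κ ∈ Dk.kolyvaginSystems (propagatedSelmerStructure W 3 k), ∃ a : ℕ, κ = a • g)
    (hcard : Nat.card (propagatedSelmerStructure W 3 k).selmerGroup = 3 ^ (k + 1) * 3 ^ n₀) :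
    ∃ e ∈ (propagatedSelmerStructure W 3 k).selmerGroup,
      ∃ m ∈ (W.kummerSelmerStructure (((3 : ℕ) : ℤ) ^ k * ((3 : ℕ) : ℤ))).selmerGroup,
        g ∅ = 3 ^ n₀ • e + m := by
  set 𝓕 := propagatedSelmerStructure W 3 k with h𝓕
  have hg0 : g ∅ ∈ 𝓕.selmerGroup :=
    ((KolyvaginDatum.mem_kolyvaginSystems_iff _ _ _).1 hg).apply_empty_mem
  -- the only level of `Dk` is `∅`
  have hlev : ∀ d : Finset (HeightOneSpectrum (𝓞 ℚ)), Dk.IsLevel d ↔ d = ∅ := fun d => by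
    rw [KolyvaginDatum.IsLevel, hP, Set.subset_empty_iff, Finset.coe_eq_empty]
  -- every Selmer class is the bottom class of a Kolyvagin system for `Dk`
  have hKS : ∀ s ∈ 𝓕.selmerGroup,
      (fun d : Finset (HeightOneSpectrum (𝓞 ℚ)) => if d = ∅ then s else 0) ∈ Dk.kolyvaginSystems 𝓕 := by
    intro s hs
    refine (KolyvaginDatum.mem_kolyvaginSystems_iff _ _ _).2 ⟨fun d hd => ?_, fun d hd => ?_, ?_⟩
    · rw [hlev] at hd
      exact if_neg hd
    · rw [hlev] at hd
      subst hd
      simpa using hs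
    · intro d _ q hq
      simp [hP] at hq
  -- hence `H¹_{𝓕_can} ⊆ ℕ•g_∅` and `#H¹_{𝓕_can} ≤ 3^{k+1}`
  have hgen0 : ∀ s ∈ 𝓕.selmerGroup, ∃ a : ℕ, s = a • g ∅ := by
    intro s hs
    obtain ⟨a, ha⟩ := hgen _ (hKS s hs)
    refine ⟨a, ?_⟩
    have := congr_fun ha ∅
    simpa using this
  obtain ⟨_, hle⟩ := KSSub.natCard_le_of_forall_eq_nsmul 𝓕.selmerGroup hg0 hgen0
    (Nat.pos_of_ne_zero (by positivity)) (Transport.pow_succ_nsmul_galoisCohomology W k (g ∅))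
  -- so `n₀ = 0`
  have hn₀ : n₀ = 0 := by
    rw [hcard] at hle
    have h1 : 3 ^ n₀ ≤ 1 :=
      Nat.le_of_mul_le_mul_left (c := 3 ^ (k + 1)) (by rw [mul_one]; exact hle)
        (pow_pos (by norm_num) _)
    have h2 : 3 ^ n₀ = 1 := le_antisymm h1 (Nat.one_le_pow _ _ (by norm_num))
    exact (Nat.pow_eq_one.mp h2).resolve_left (by norm_num)
  subst hn₀
  exact ⟨g ∅, hg0, 0, zero_mem _, by simp⟩

/-- **Kolyvagin primes INVISIBLE to `H¹_{𝓕_can}` are harmless for the crux** (generalises the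
prime-free case to the "totally useless" end of the sub-data): if every class of
`H¹_{𝓕_can}(ℚ, E[3^{k+1}])` is locally ZERO at every prime of `Dk`, then every such class `s` is the
bottom class of the CONSTANT Kolyvagin system `d ↦ s` on the levels of `Dk` (`0` off them) — `s` is
transverse at the primes of every level, being `0` there, and both sides of every finite–singular
relation `v_𝔮(κ_{d𝔮}) = φ^{fs}_𝔮(κ_d)` vanish.  Hence `ℕ`-cyclicity of `KS` forces
`H¹_{𝓕_can} ⊆ ℕ•g_∅`, `#H¹_{𝓕_can} ≤ 3^{k+1}`, `n₀ = 0`, and the crux's conclusion holds with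
`e = g_∅`, `m = 0`.  (So the Chebotarev-poor extreme of the `∀`-sub-data quantifier is as harmless as
the empty one; the open middle is a datum whose primes see some but not all of the Selmer classes.)
[cite: Sakamoto2024, Def. 3.3 (p. 922) and Def. 4.1 (p. 926)] [cite: MazurRubin2004, Def. 3.1.3] -/
theorem exists_eq_nsmul_add_of_forall_localization_eq_zero (k n₀ : ℕ)
    {Dk : KolyvaginDatum (W.torsionGaloisModule (((3 : ℕ) : ℤ) ^ k * ((3 : ℕ) : ℤ)))}
    (hloc : ∀ q ∈ Dk.primes, ∀ s ∈ (propagatedSelmerStructure W 3 k).selmerGroup,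
      galoisCohomology.localization (W.torsionGaloisModule (((3 : ℕ) : ℤ) ^ k * ((3 : ℕ) : ℤ)))
        (Sum.inr q) 1 s = 0)
    {g : Finset (HeightOneSpectrum (𝓞 ℚ)) →
      galoisCohomology (W.torsionGaloisModule (((3 : ℕ) : ℤ) ^ k * ((3 : ℕ) : ℤ))) 1}
    (hg : g ∈ Dk.kolyvaginSystems (propagatedSelmerStructure W 3 k))
    (hgen : ∀ κ ∈ Dk.kolyvaginSystems (propagatedSelmerStructure W 3 k), ∃ a : ℕ, κ = a • g)
    (hcard : Nat.card (propagatedSelmerStructure W 3 k).selmerGroup = 3 ^ (k + 1) * 3 ^ n₀) :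
    ∃ e ∈ (propagatedSelmerStructure W 3 k).selmerGroup,
      ∃ m ∈ (W.kummerSelmerStructure (((3 : ℕ) : ℤ) ^ k * ((3 : ℕ) : ℤ))).selmerGroup,
        g ∅ = 3 ^ n₀ • e + m := by
  set 𝓕 := propagatedSelmerStructure W 3 k with h𝓕
  have hg0 : g ∅ ∈ 𝓕.selmerGroup :=
    ((KolyvaginDatum.mem_kolyvaginSystems_iff _ _ _).1 hg).apply_empty_mem
  -- every Selmer class is the bottom class of the CONSTANT Kolyvagin system on the levels of `Dk`
  have hKS : ∀ s ∈ 𝓕.selmerGroup,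
      (fun d : Finset (HeightOneSpectrum (𝓞 ℚ)) => if Dk.IsLevel d then s else 0) ∈
        Dk.kolyvaginSystems 𝓕 := by
    intro s hs
    refine (KolyvaginDatum.mem_kolyvaginSystems_iff _ _ _).2
      ⟨fun d hd => if_neg hd, fun d hd => ?_, fun d hd q hq _ => ?_⟩
    · rw [if_pos hd, SelmerStructure.mem_selmerGroup_iff]
      intro v
      rcases v with w | q
      · rw [CoreRankZero.Level.atLevel_inl]
        exact (SelmerStructure.mem_selmerGroup_iff _ _).1 hs (Sum.inl w)
      · by_cases hqd : q ∈ d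
        · rw [CoreRankZero.Level.atLevel_inr_of_mem Dk 𝓕 hqd, hloc q (hd (Finset.mem_coe.2 hqd)) s hs]
          exact zero_mem _
        · rw [CoreRankZero.Level.atLevel_inr_of_not_mem Dk 𝓕 hqd]
          exact (SelmerStructure.mem_selmerGroup_iff _ _).1 hs (Sum.inr q)
    · rw [if_pos (hd.insert hq), if_pos hd]
      have h0 := hloc q hq s hs
      have h1 : KolyvaginDatum.singularLocalization
          (W.torsionGaloisModule (((3 : ℕ) : ℤ) ^ k * ((3 : ℕ) : ℤ))) q s = 0 :=
        (congrArg (singularMap (GaloisRep.toLocal q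
          (W.torsionGaloisModule (((3 : ℕ) : ℤ) ^ k * ((3 : ℕ) : ℤ))))) h0).trans (map_zero _)
      have h2 : Dk.fsLocalization q s = 0 := (congrArg (Dk.fs q) h0).trans (map_zero _)
      rw [h1, h2]
  -- hence `H¹_{𝓕_can} ⊆ ℕ•g_∅` and `#H¹_{𝓕_can} ≤ 3^{k+1}`
  have hgen0 : ∀ s ∈ 𝓕.selmerGroup, ∃ a : ℕ, s = a • g ∅ := by
    intro s hs
    obtain ⟨a, ha⟩ := hgen _ (hKS s hs)
    refine ⟨a, ?_⟩
    have := congr_fun ha ∅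
    simpa using this
  obtain ⟨_, hle⟩ := KSSub.natCard_le_of_forall_eq_nsmul 𝓕.selmerGroup hg0 hgen0
    (Nat.pos_of_ne_zero (by positivity)) (Transport.pow_succ_nsmul_galoisCohomology W k (g ∅))
  -- so `n₀ = 0`
  have hn₀ : n₀ = 0 := by
    rw [hcard] at hle
    have h1 : 3 ^ n₀ ≤ 1 :=
      Nat.le_of_mul_le_mul_left (c := 3 ^ (k + 1)) (by rw [mul_one]; exact hle)
        (pow_pos (by norm_num) _)
    have h2 : 3 ^ n₀ = 1 := le_antisymm h1 (Nat.one_le_pow _ _ (by norm_num))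
    exact (Nat.pow_eq_one.mp h2).resolve_left (by norm_num)
  subst hn₀
  exact ⟨g ∅, hg0, 0, zero_mem _, by simp⟩

end Summit.BirchSwinnertonDyer.BirchSwinnertonDyer.Theorems.KimAtThreeStubSubdatum

end
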